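import Literature.NumberTheory.EllipticCurves.IsogenyDualKernelLocalKummer
import Literature.NumberTheory.EllipticCurves.KubertTateSevenSelmerTame
import Literature.NumberTheory.EllipticCurves.KubertTateSevenKummerDivisor
import Literature.NumberTheory.EllipticCurves.KubertTateSevenRationalTorsion
import Literature.NumberTheory.EllipticCurves.KubertTateSevenKummerValuation
import Literature.NumberTheory.EllipticCurves.KubertTateFiveMuDescent
import HarnessLib

/-!
# The `μ₇`-side of the `7`-descent on the Kubert–Tate family
# `E_{m,n} : y² + (n² + mn − m²)xy + m²n³(n−m)y = x³ + m²n(n−m)x²`: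
# `#Sel^ψ(E'/ℚ) ≤ 7^{ω(mn(m−n))}`, `rank ≤ ω(mn(m−n)) − 1` in the tame régime, and `Ш(E_{m,n}/ℚ)[7] = 0`
# when the rational points fill the box

PROOF-ONLY file (theorems; two private valuation/transport helpers and one `Fact (Nat.Prime 7)` instance;
no definition, no named fact, no `sorry`), topic `NumberTheory/EllipticCurves`; the `7`-torsion sibling of
`KubertTateFiveMuDescent`, which it follows declaration by declaration. Setting: `E = kubertTateSeven m n`
over `ℚ` (elliptic; parameters `m n : ℤ`), `T = (0,0)` of order `7`, `φ : E → E' = E/⟨T⟩` Vélu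
(`KubertTateSevenVelu.sevenIsogeny`), `ψ : E' → E` ANY isogeny with `ψ ∘ φ = [7]`, and ONE rational point
`P₁ ∈ E(ℚ)` with `49 P₁ ≠ O` (a reference point for the Kummer invariant; any point of infinite order).
`S = ` the prime factors of `mn(m − n)`.

* §1 `kummer_local` — the local condition of `Sel^ψ(E'/ℚ)` at a `ℚ`-field `L` read in `Lˣ/Lˣ⁷` through the
  Kummer invariant (`IsogenyDualKernelMuCharacter.kummerInvariant`) and the Kummer function
  `f_T = x²y − n(m+n)x³ + n³(2m+n)xy − m²n⁴x² + m²n⁶y` (`KubertTateSevenKummer.kummerFn₇`, divisor `7(T) − 7(O)`):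
  for a Kummer generator `(α, a)` of a cocycle whose class dies in `H¹(L, E')`, `(ιa)ᵏ = u⁷` or
  `(ιa)ᵏ · u⁷ · ι f_T(7P₁) = f_T(x, y)` at an `L`-point `(x, y) ≠ T` of `E`, `7 ∤ k`.
* §2 `seven_dvd_padicValRat_of_kummer_local` — over `ℚ_q`, `q ∉ S`: `7 ∣ v_q(a)` (valuation law
  `KubertTateSevenKummer.exists_val_kummerFn₇_eq_pow` at the `q`-adic norm, `m, n, m − n` being `q`-units),
  transported to the Selmer completions `ℚ_v ≃ₐ[ℚ] ℚ_q`: `seven_dvd_padicValRat_of_mem_selmerGroup`.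
* §3 **`natCard_selmerGroup_dual_le : #Sel^ψ(E'/ℚ) ≤ 7 ^ #S`** (injective Kummer invariant + `(v_q mod 7)_{q ∈ S}`;
  a rational number all of whose valuations are divisible by `7` is a seventh power).
* §4 In the TAME régime (`7 ∤ Δ`, no bad prime `≡ 1 (mod 7)`: `Sel^φ = 0`, tree `KubertTateSevenSelmerTame`):
  `natCard_selmerGroup_dual_eq : #Sel^ψ = #(E(ℚ)/7E(ℚ)) · #ker Ш(ψ)`, hence
  **`natCard_quotient_le : #(E(ℚ)/7E(ℚ)) ≤ 7 ^ #S`**, **`pow_mordellWeilRank_succ_le : 7^{rank + 1} ≤ 7 ^ #S`** (so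
  `rank E_{m,n}(ℚ) ≤ ω(mn(m−n)) − 1`), and, when the rational points FILL the box (`7 ^ #S ≤ #(E(ℚ)/7E(ℚ))`):
  **`ker_shaMap_dual_eq_bot_of_le`, `sha_torsionBy_seven_eq_bot_of_le : Ш(E_{m,n}/ℚ)[7] = 0`,
  `shaCorank_seven_eq_zero_of_le : t₇(E_{m,n}) = 0`** — descent alone, no `L`-function, any rank.

## References

* [SilvermanAEC2009] J. H. Silverman, *AEC*, 2nd ed., Thm. X.4.2, Prop. X.4.9, Exercise 10.1(c), Thm. X.1.1.
* [Fisher2001FiveSevenDescent] T. Fisher, *Some examples of 5 and 7 descent for elliptic curves over ℚ*,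
  JEMS 3 (2001) 169–201, §§1–2 (`7`-descent on curves with a `7`-torsion point).
* [Kubert1976] D. S. Kubert, *Universal bounds on the torsion of elliptic curves*, Table 3 (`N = 7`).
-/

noncomputable section

open scoped Classical NNReal NumberField AddSubgroup
open WeierstrassCurve WeierstrassCurve.Isogeny Field IsDedekindDomain
open Literature.NumberTheory.EllipticCurves Literature.NumberTheory.EllipticCurves.KubertTateSevenKummer
  Literature.NumberTheory.EllipticCurves.KubertTateSevenVelu Literature.NumberTheory.GaloisRepresentations
  Literature.NumberTheory.EllipticCurves.WeierstrassFunctionField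

-- The `ℚ`-algebra diamond (`DivisionRing.toRatAlgebra` vs the structural `ℚ`-algebra instances on
-- `v.adicCompletion ℚ` and `AlgebraicClosure ℚ`): same device as `KubertTateFiveMuDescent`.
attribute [-instance] DivisionRing.toRatAlgebra

namespace Literature.NumberTheory.EllipticCurves

namespace KubertTateSevenMuDescent

/-- `7` is prime. [folklore] -/
private theorem prime_seven' : Nat.Prime 7 := by norm_num

/-- `Fact (Nat.Prime 7)` for the `μ₇`-Kummer theory (`muVal ℚ 7`, `ZMod 7`). [folklore] -/
instance fact_prime_seven : Fact (Nat.Prime 7) := ⟨prime_seven'⟩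


/-! ## §0 The data: `E_{m,n}`, the dual pair `(φ, ψ)`, `T̄`, a reference point `P₁` -/

variable (m n : ℤ) [hE : (kubertTateSeven (m : ℚ) (n : ℚ)).IsElliptic]
variable (ψ : Isogeny (kubertTateSeven' (m : ℚ) (n : ℚ)) (kubertTateSeven (m : ℚ) (n : ℚ)))
  (hψ : ∀ P, ψ (sevenIsogeny (m : ℚ) (n : ℚ) P) = ((7 : ℕ) : ℤ) • P)

/-- **The dual exists**: an isogeny `ψ : E' → E` with `ψ ∘ φ = [7]` (Silverman III.6.1, tree
`Isogeny.exists_dual_of_isElliptic`; `deg φ = #ker φ = 7`). [cite: SilvermanAEC2009, Thm. III.6.1(a)] -/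
theorem exists_dual : ∃ ψ : Isogeny (kubertTateSeven' (m : ℚ) (n : ℚ)) (kubertTateSeven (m : ℚ) (n : ℚ)),
    ∀ P, ψ (sevenIsogeny (m : ℚ) (n : ℚ) P) = ((7 : ℕ) : ℤ) • P := by
  obtain ⟨ψ, hψ⟩ := (sevenIsogeny (m : ℚ) (n : ℚ)).exists_dual_of_isElliptic
  refine ⟨ψ, fun P ↦ ?_⟩
  rw [hψ, Isogeny.degree, natCard_ker_sevenIsogeny]

include hψ in
/-- `φ ∘ ψ = [7]` on `E'(ℚ̄)` (`φ` is onto `E'(ℚ̄)`). [cite: SilvermanAEC2009, Thm. III.6.2(a)] -/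
theorem comp_dual_eq (Q : geomPoints (kubertTateSeven' (m : ℚ) (n : ℚ))) :
    sevenIsogeny (m : ℚ) (n : ℚ) (ψ Q) = ((7 : ℕ) : ℤ) • Q := by
  obtain ⟨P, rfl⟩ := (sevenIsogeny (m : ℚ) (n : ℚ)).surjective Q
  rw [hψ, map_zsmul]

/-- Two affine points with equal coordinates are equal (proof-irrelevant form). [folklore] -/
private theorem some_eq_some_of_eq {R : Type*} [CommRing R] {V : WeierstrassCurve R}
    {x y x' y' : R} (hx : x = x') (hy : y = y') (h : V.toAffine.Nonsingular x y)
    (h' : V.toAffine.Nonsingular x' y') : Affine.Point.some x y h = Affine.Point.some x' y' h' := by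
  subst hx hy; rfl

variable (P₁ : geomPoints (kubertTateSeven (m : ℚ) (n : ℚ)))
  (hP₁ : ∀ σ : absoluteGaloisGroup ℚ, σ • P₁ = P₁) (h49 : ((49 : ℕ) : ℤ) • P₁ ≠ 0)

omit hE in
/-- The Weierstrass equation of `E` over `ℚ` in the Kubert–Tate shape. [cite: Kubert1976, Table 3 (N = 7)] -/
theorem equation_iff_rat (x y : ℚ) :
    (kubertTateSeven (m : ℚ) (n : ℚ)).toAffine.Equation x y ↔
      y ^ 2 + ((n : ℚ) ^ 2 + m * n - m ^ 2) * x * y + m ^ 2 * (n : ℚ) ^ 3 * (n - m) * y = x ^ 3 + m ^ 2 * n * (n - m) * x ^ 2 := by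
  rw [Affine.equation_iff]
  simp only [kubertTateSeven]
  constructor <;> intro h <;> linear_combination h

-- `ι_*` of a rational affine point is the point of `E(ℚ̄)` with the same coordinates:
-- `KubertTateSevenTorsion.toGeomPoints_some` (tree, `KubertTateFiveRationalTorsion`).

include hP₁ h49 in
/-- `7P₁` is an affine point `(x₀, y₀) ≠ T = (0, 0)` with rational coordinates (Galois descent for the fixed
point `7P₁`; `49 P₁ ≠ O` and `7T = O`). [cite: SilvermanAEC2009, VIII.§1] -/
theorem exists_seven_zsmul_eq : ∃ (x₀ y₀ : ℚ)
    (h₀' : ((kubertTateSeven (m : ℚ) (n : ℚ)).baseChange (AlgebraicClosure ℚ)).toAffine.Nonsingular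
      (algebraMap ℚ (AlgebraicClosure ℚ) x₀) (algebraMap ℚ (AlgebraicClosure ℚ) y₀)),
    ((7 : ℕ) : ℤ) • P₁ = .some _ _ h₀' ∧ ¬ (x₀ = 0 ∧ y₀ = 0) ∧
      y₀ ^ 2 + ((n : ℚ) ^ 2 + m * n - m ^ 2) * x₀ * y₀ + m ^ 2 * (n : ℚ) ^ 3 * (n - m) * y₀ = x₀ ^ 3 + m ^ 2 * n * (n - m) * x₀ ^ 2 := by
  have hfix : ∀ σ : absoluteGaloisGroup ℚ, σ • (((7 : ℕ) : ℤ) • P₁) = ((7 : ℕ) : ℤ) • P₁ := fun σ ↦ by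
    rw [smul_comm, hP₁]
  have h55 : ((49 : ℕ) : ℤ) • P₁ = ((7 : ℕ) : ℤ) • (((7 : ℕ) : ℤ) • P₁) := by
    rw [← mul_zsmul]; norm_num
  obtain ⟨R, hR⟩ := exists_toGeomPoints_eq_of_forall_smul_eq (W := kubertTateSeven (m : ℚ) (n : ℚ)) hfix
  rcases R with _ | ⟨x₀, y₀, h₀⟩
  · exfalso
    apply h49
    rw [h55, ← hR]
    exact (zsmul_zero _ : ((7 : ℕ) : ℤ) • (0 : geomPoints (kubertTateSeven (m : ℚ) (n : ℚ))) = 0)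
  · obtain ⟨h₀', e⟩ := KubertTateSevenTorsion.toGeomPoints_some m n h₀
    refine ⟨x₀, y₀, h₀', hR.symm.trans e, ?_, (equation_iff_rat m n x₀ y₀).mp h₀.left⟩
    rintro ⟨rfl, rfl⟩
    apply h49
    rw [h55, ← hR, e, ← Tbar_eq_some]
    exact seven_zsmul_Tbar (m : ℚ) (n : ℚ)
  where
  /-- `T̄ = (ι 0, ι 0)`. -/
  Tbar_eq_some (h' : ((kubertTateSeven (m : ℚ) (n : ℚ)).baseChange (AlgebraicClosure ℚ)).toAffine.Nonsingular
      (algebraMap ℚ (AlgebraicClosure ℚ) 0) (algebraMap ℚ (AlgebraicClosure ℚ) 0)) :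
      Tbar (m : ℚ) (n : ℚ) = .some _ _ h' := by
    rw [Tbar_eq]; exact some_eq_some_of_eq (map_zero _).symm (map_zero _).symm _ _

/-! ## §1 The local condition at a `ℚ`-field `L`, read in `Lˣ/Lˣ⁷` -/

section Local

variable (L : Type) [Field L] [Algebra ℚ L] [CharZero L]

omit [Algebra ℚ L] [CharZero L] in
/-- Transport of Kummer-function data along an equality of Weierstrass curves (both sides variables;
`subst`). [folklore] -/
private theorem kummerData_transport {V V' : WeierstrassCurve L} [V.IsElliptic] [V'.IsElliptic] (e : V = V')
    (m' n' : L)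
    (h0' : (V'.baseChange (AlgebraicClosure L)).toAffine.Nonsingular 0 0)
    (hf : ∃ f : V'.geomFunctionField, f ≠ 0 ∧
      (∀ Q : geomPoints V', ord (V'.baseChange (AlgebraicClosure L)).toAffine Q f =
        ((7 : ℕ) : ℤ) * ((if Q = Affine.Point.some 0 0 h0' then 1 else 0) - (if Q = 0 then 1 else 0))) ∧
      (∀ (x y : AlgebraicClosure L) (h : (V'.baseChange (AlgebraicClosure L)).toAffine.Nonsingular x y),
        V'.HasValueAt f (Affine.Point.some x y h)
          (x ^ 2 * y - algebraMap L (AlgebraicClosure L) n' *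
              (algebraMap L (AlgebraicClosure L) m' + algebraMap L (AlgebraicClosure L) n') * x ^ 3
            + algebraMap L (AlgebraicClosure L) n' ^ 3 *
              (2 * algebraMap L (AlgebraicClosure L) m' + algebraMap L (AlgebraicClosure L) n') * x * y
            - algebraMap L (AlgebraicClosure L) m' ^ 2 * algebraMap L (AlgebraicClosure L) n' ^ 4 * x ^ 2
            + algebraMap L (AlgebraicClosure L) m' ^ 2 * algebraMap L (AlgebraicClosure L) n' ^ 6 * y)))
    (h0 : (V.baseChange (AlgebraicClosure L)).toAffine.Nonsingular 0 0) :
    ∃ f : V.geomFunctionField, f ≠ 0 ∧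
      (∀ Q : geomPoints V, ord (V.baseChange (AlgebraicClosure L)).toAffine Q f =
        ((7 : ℕ) : ℤ) * ((if Q = Affine.Point.some 0 0 h0 then 1 else 0) - (if Q = 0 then 1 else 0))) ∧
      (∀ (x y : AlgebraicClosure L) (h : (V.baseChange (AlgebraicClosure L)).toAffine.Nonsingular x y),
        V.HasValueAt f (Affine.Point.some x y h)
          (x ^ 2 * y - algebraMap L (AlgebraicClosure L) n' *
              (algebraMap L (AlgebraicClosure L) m' + algebraMap L (AlgebraicClosure L) n') * x ^ 3
            + algebraMap L (AlgebraicClosure L) n' ^ 3 *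
              (2 * algebraMap L (AlgebraicClosure L) m' + algebraMap L (AlgebraicClosure L) n') * x * y
            - algebraMap L (AlgebraicClosure L) m' ^ 2 * algebraMap L (AlgebraicClosure L) n' ^ 4 * x ^ 2
            + algebraMap L (AlgebraicClosure L) m' ^ 2 * algebraMap L (AlgebraicClosure L) n' ^ 6 * y)) := by
  subst e
  exact hf

omit hE [CharZero L] in
/-- `E_{m,n} ⊗ L = E_{m,n}/L` (the family is stable under base change, tree `map_kubertTateSeven`).
[cite: Kubert1976, Table 3 (N = 7)] -/
theorem baseChange_eq : (kubertTateSeven (m : ℚ) (n : ℚ)).baseChange L = kubertTateSeven (m : L) (n : L) := by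
  rw [show (kubertTateSeven (m : ℚ) (n : ℚ)).baseChange L = (kubertTateSeven (m : ℚ) (n : ℚ)).map (algebraMap ℚ L)
    from rfl, map_kubertTateSeven, map_intCast, map_intCast]

omit hE [CharZero L] in
/-- `ι_*` of a point of `E(ℚ̄)` with rational coordinates is the point of `E_L(L̄)` with the same coordinates.
[cite: SilvermanAEC2009, VIII.§1] -/
theorem baseExt_some_algebraMap {x y : ℚ}
    (h₁ : ((kubertTateSeven (m : ℚ) (n : ℚ)).baseChange (AlgebraicClosure ℚ)).toAffine.Nonsingular
      (algebraMap ℚ (AlgebraicClosure ℚ) x) (algebraMap ℚ (AlgebraicClosure ℚ) y)) :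
    ∃ h', baseExt (kubertTateSeven (m : ℚ) (n : ℚ)) L (.some _ _ h₁) =
      .some (algebraMap ℚ (AlgebraicClosure L) x) (algebraMap ℚ (AlgebraicClosure L) y) h' := by
  obtain ⟨h₂, e₂⟩ := Isogeny.localPointsEquivGeomPoints_pointsMap_some L (kubertTateSeven (m : ℚ) (n : ℚ)) h₁
  rw [baseExt_apply, e₂]
  have hx : closureEmb (K := ℚ) L (algebraMap ℚ (AlgebraicClosure ℚ) x) = algebraMap ℚ (AlgebraicClosure L) x :=
    (closureEmb (K := ℚ) L).commutes x
  have hy : closureEmb (K := ℚ) L (algebraMap ℚ (AlgebraicClosure ℚ) y) = algebraMap ℚ (AlgebraicClosure L) y :=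
    (closureEmb (K := ℚ) L).commutes y
  exact ⟨by rw [← hx, ← hy]; exact h₂, some_eq_some_of_eq hx hy _ _⟩

omit [CharZero L] in
/-- `T_L = ι_* T̄ = (0, 0)` in `E_L(L̄)`. [cite: Kubert1976, Table 3 (N = 7)] -/
theorem baseExt_Tbar : ∃ h', baseExt (kubertTateSeven (m : ℚ) (n : ℚ)) L (Tbar (m : ℚ) (n : ℚ)) = .some 0 0 h' := by
  obtain ⟨h₂, e₂⟩ := Isogeny.localPointsEquivGeomPoints_pointsMap_some L (kubertTateSeven (m : ℚ) (n : ℚ))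
    (KubertTateSevenVelu.nonsingular_zero_zero (m : ℚ) (n : ℚ))
  rw [Tbar_eq, baseExt_apply, e₂]
  have h0 : closureEmb (K := ℚ) L (0 : AlgebraicClosure ℚ) = 0 := map_zero _
  exact ⟨by rw [← h0]; exact h₂, some_eq_some_of_eq h0 h0 _ _⟩

omit [CharZero L] in
/-- **A Kummer function `f_T` on `E_L` with `div f_T = 7(T_L) − 7(O)` and values
`f_T(x, y) = x²y − n(m+n)x³ + n³(2m+n)xy − m²n⁴x² + m²n⁶y`** (the tree's `KubertTateSevenKummer.kummerFn₇ m n`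
over `L`, transported along `E ⊗ L = E_{m,n}/L`). [cite: SilvermanAEC2009, Exercise 10.1(c)] [cite: Fisher2001FiveSevenDescent, §1] -/
theorem exists_kummerFn (h0 : (((kubertTateSeven (m : ℚ) (n : ℚ)).baseChange L).baseChange (AlgebraicClosure L)).toAffine.Nonsingular 0 0) :
    ∃ f : ((kubertTateSeven (m : ℚ) (n : ℚ)).baseChange L).geomFunctionField, f ≠ 0 ∧
      (∀ Q : geomPoints ((kubertTateSeven (m : ℚ) (n : ℚ)).baseChange L),
        ord (((kubertTateSeven (m : ℚ) (n : ℚ)).baseChange L).baseChange (AlgebraicClosure L)).toAffine Q f =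
        ((7 : ℕ) : ℤ) * ((if Q = Affine.Point.some 0 0 h0 then 1 else 0) - (if Q = 0 then 1 else 0))) ∧
      (∀ (x y : AlgebraicClosure L) (h : (((kubertTateSeven (m : ℚ) (n : ℚ)).baseChange L).baseChange
          (AlgebraicClosure L)).toAffine.Nonsingular x y),
        ((kubertTateSeven (m : ℚ) (n : ℚ)).baseChange L).HasValueAt f (Affine.Point.some x y h)
          (x ^ 2 * y - algebraMap L (AlgebraicClosure L) (n : L) *
              (algebraMap L (AlgebraicClosure L) (m : L) + algebraMap L (AlgebraicClosure L) (n : L)) * x ^ 3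
            + algebraMap L (AlgebraicClosure L) (n : L) ^ 3 *
              (2 * algebraMap L (AlgebraicClosure L) (m : L) + algebraMap L (AlgebraicClosure L) (n : L)) * x * y
            - algebraMap L (AlgebraicClosure L) (m : L) ^ 2 * algebraMap L (AlgebraicClosure L) (n : L) ^ 4 * x ^ 2
            + algebraMap L (AlgebraicClosure L) (m : L) ^ 2 * algebraMap L (AlgebraicClosure L) (n : L) ^ 6 * y)) := by
  haveI : (kubertTateSeven (m : L) (n : L)).IsElliptic :=
    baseChange_eq m n L ▸ isElliptic_baseChange (kubertTateSeven (m : ℚ) (n : ℚ)) L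
  refine kummerData_transport L (baseChange_eq m n L) (m : L) (n : L)
    (KubertTateSevenVelu.nonsingular_zero_zero (m : L) (n : L))
    ⟨kummerFn₇ (m : L) (n : L), kummerFn₇_ne_zero (m : L) (n : L), fun Q ↦ ?_,
      fun x y h ↦ hasValueAt_kummerFn₇ (m : L) (n : L) h⟩ h0
  rw [ord_kummerFn₇ (m : L) (n : L) Q, Tbar_eq]

omit hE in
/-- A `Γ_L`-fixed point of `E_L(L̄)` off `O` is `(x, y)` with `x, y ∈ L`. [cite: SilvermanAEC2009, VIII.§1] -/
theorem exists_eq_some_of_fixed {P : geomPoints ((kubertTateSeven (m : ℚ) (n : ℚ)).baseChange L)}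
    (hfix : ∀ τ : absoluteGaloisGroup L, τ • P = P) (hP0 : P ≠ 0) :
    ∃ (x y : L) (_ : ((kubertTateSeven (m : ℚ) (n : ℚ)).baseChange L).toAffine.Nonsingular x y)
      (h' : (((kubertTateSeven (m : ℚ) (n : ℚ)).baseChange L).baseChange (AlgebraicClosure L)).toAffine.Nonsingular
        (algebraMap L (AlgebraicClosure L) x) (algebraMap L (AlgebraicClosure L) y)),
      P = Affine.Point.some (algebraMap L (AlgebraicClosure L) x) (algebraMap L (AlgebraicClosure L) y) h' := by
  obtain ⟨Pr, hPr⟩ := exists_toGeomPoints_eq_of_forall_smul_eq (W := (kubertTateSeven (m : ℚ) (n : ℚ)).baseChange L) hfix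
  rcases Pr with _ | ⟨x, y, h⟩
  · exact absurd (hPr.symm.trans (map_zero _)) hP0
  · exact ⟨x, y, h, _, by rw [← hPr]; exact Affine.Point.map_some _ h⟩

omit hE [CharZero L] in
/-- The Weierstrass equation of `E ⊗ L` in the Kubert–Tate shape. [cite: Kubert1976, Table 3 (N = 7)] -/
theorem equation_iff (x y : L) :
    ((kubertTateSeven (m : ℚ) (n : ℚ)).baseChange L).toAffine.Equation x y ↔
      y ^ 2 + ((n : L) ^ 2 + m * n - m ^ 2) * x * y + m ^ 2 * (n : L) ^ 3 * (n - m) * y = x ^ 3 + m ^ 2 * n * (n - m) * x ^ 2 := by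
  rw [baseChange_eq, Affine.equation_iff]
  simp only [kubertTateSeven]
  constructor <;> intro h <;> linear_combination h

include hP₁ h49 in
/-- **The local condition of `Sel^ψ(E'/ℚ)` at `L`, read in `Lˣ/Lˣ⁷`.** Let `c : Γ_ℚ → ker ψ` be a cocycle whose
class dies in `H¹(L, E')` (`[c] ∈ ψ.selmerLocalKer L`) and `(α, a)` a Kummer generator of `c`. Then for some `k`
with `7 ∤ k`, `u ∈ Lˣ` and `7P₁ = (x₀, y₀)`: either `(ιa)ᵏ = u⁷` in `L`, or
`(ιa)ᵏ · u⁷ · ι f_T(x₀, y₀) = f_T(x, y)` for an `L`-rational affine point `(x, y) ≠ (0,0) = T` of `E`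
(`f_T = x²y − n(m+n)x³ + n³(2m+n)xy − m²n⁴x² + m²n⁶y`). [cite: SilvermanAEC2009, Prop. X.4.9 and Exercise 10.1(c)] [cite: Fisher2001FiveSevenDescent, §2] -/
theorem kummer_local
    (c : letI := ψ.kerAction
      contOneCocycles (discreteTopRep (absoluteGaloisGroup ℚ) ψ.toAddMonoidHom.ker))
    (hsel : letI := ψ.kerAction
      oneCocycleClass _ c ∈ ψ.selmerLocalKer L)
    {α : (AlgebraicClosure ℚ)ˣ} {a : ℚˣ}
    (hαp : α ^ 7 = Units.map (algebraMap ℚ (AlgebraicClosure ℚ) : ℚ →* AlgebraicClosure ℚ) a)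
    (hcα : ∀ σ : absoluteGaloisGroup ℚ, muVal ℚ 7 (dualKerChar (sevenIsogeny (m : ℚ) (n : ℚ)) ψ hψ (Tbar (m : ℚ) (n : ℚ))
      (seven_zsmul_Tbar (m : ℚ) (n : ℚ)) (ker_sevenIsogeny_eq_zmultiples (m : ℚ) (n : ℚ)) (c.1 σ)) = σ • α / α) :
    ∃ (k : ℕ) (u x y : L) (x₀ y₀ : ℚ), ¬ 7 ∣ k ∧ u ≠ 0 ∧
      ((algebraMap ℚ L a) ^ k = u ^ 7 ∨
        ((y ^ 2 + ((n : L) ^ 2 + m * n - m ^ 2) * x * y + m ^ 2 * (n : L) ^ 3 * (n - m) * y = x ^ 3 + m ^ 2 * n * (n - m) * x ^ 2 ∧ ¬ (x = 0 ∧ y = 0)) ∧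
         (y₀ ^ 2 + ((n : ℚ) ^ 2 + m * n - m ^ 2) * x₀ * y₀ + m ^ 2 * (n : ℚ) ^ 3 * (n - m) * y₀ = x₀ ^ 3 + m ^ 2 * n * (n - m) * x₀ ^ 2 ∧ ¬ (x₀ = 0 ∧ y₀ = 0)) ∧
          (algebraMap ℚ L a) ^ k * u ^ 7 * algebraMap ℚ L (x₀ ^ 2 * y₀ - n * (m + n) * x₀ ^ 3 + (n : ℚ) ^ 3 * (2 * m + n) * x₀ * y₀ - m ^ 2 * (n : ℚ) ^ 4 * x₀ ^ 2 + m ^ 2 * (n : ℚ) ^ 6 * y₀) =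
            x ^ 2 * y - n * (m + n) * x ^ 3 + (n : L) ^ 3 * (2 * m + n) * x * y - m ^ 2 * (n : L) ^ 4 * x ^ 2 + m ^ 2 * (n : L) ^ 6 * y)) := by
  letI := ψ.kerAction
  set φ := sevenIsogeny (m : ℚ) (n : ℚ) with hφdef
  set T₀ := Tbar (m : ℚ) (n : ℚ) with hT₀
  have hT : ((7 : ℕ) : ℤ) • T₀ = 0 := seven_zsmul_Tbar (m : ℚ) (n : ℚ)
  have hT0 : T₀ ≠ 0 := Tbar_ne_zero (m : ℚ) (n : ℚ)
  have hTfix : ∀ σ : absoluteGaloisGroup ℚ, σ • T₀ = T₀ := smul_Tbar (m : ℚ) (n : ℚ)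
  have hker : φ.toAddMonoidHom.ker = AddSubgroup.zmultiples T₀ := ker_sevenIsogeny_eq_zmultiples (m : ℚ) (n : ℚ)
  -- the base-changed isogenies
  obtain ⟨φL, hφL, -, hφLcard⟩ := Isogeny.exists_baseChange_field L φ
  obtain ⟨ψL, hψL, -, -⟩ := Isogeny.exists_baseChange_field L ψ
  letI := ψL.kerAction
  have hφL' : ∀ P : (kubertTateSeven (m : ℚ) (n : ℚ)).geomPoints, φL (baseExt (kubertTateSeven (m : ℚ) (n : ℚ)) L P) = baseExt (kubertTateSeven' (m : ℚ) (n : ℚ)) L (φ P) := fun P ↦ hφL P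
  have hψL' : ∀ Q : (kubertTateSeven' (m : ℚ) (n : ℚ)).geomPoints, ψL (baseExt (kubertTateSeven' (m : ℚ) (n : ℚ)) L Q) = baseExt (kubertTateSeven (m : ℚ) (n : ℚ)) L (ψ Q) := fun Q ↦ hψL Q
  have hφLcard' : Nat.card φL.toAddMonoidHom.ker = 7 := hφLcard.trans (natCard_ker_sevenIsogeny (m : ℚ) (n : ℚ))
  have hLp := comp_eq_zsmul_of_baseChange φ ψ hψ L φL ψL hφL' hψL'
  -- the Selmer condition at `L`: a coboundary `Q'`
  obtain ⟨Q', hQ'⟩ := exists_coboundary_of_mem_selmerLocalKer ψ L ψL hψL' c hsel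
  -- `T_L = (0,0)` and the base point `Q₀ = ι_* P₁`, `5Q₀ = ι_* (x₀, y₀)`
  obtain ⟨hT00, eTL⟩ := baseExt_Tbar m n L
  obtain ⟨x₀, y₀, h₀', e₅, hT₅, he₀⟩ := exists_seven_zsmul_eq m n P₁ hP₁ h49
  set Q₀ : geomPoints ((kubertTateSeven (m : ℚ) (n : ℚ)).baseChange L) :=
    baseExt (kubertTateSeven (m : ℚ) (n : ℚ)) L P₁ with hQ₀def
  have hQ₀fix : ∀ τ : absoluteGaloisGroup L, τ • Q₀ = Q₀ := fun τ ↦ by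
    rw [hQ₀def, ← baseExt_smul, hP₁]
  have h5Q₀ : ((7 : ℕ) : ℤ) • Q₀ = baseExt (kubertTateSeven (m : ℚ) (n : ℚ)) L (((7 : ℕ) : ℤ) • P₁) := by
    rw [hQ₀def, map_zsmul]
  have h49' : ∀ R : geomPoints (kubertTateSeven (m : ℚ) (n : ℚ)), ((7 : ℕ) : ℤ) • R = 0 →
      ((7 : ℕ) : ℤ) • P₁ ≠ R := by
    intro R hR hPR
    apply h49
    rw [show ((49 : ℕ) : ℤ) • P₁ = ((7 : ℕ) : ℤ) • (((7 : ℕ) : ℤ) • P₁) by rw [← mul_zsmul]; norm_num, hPR, hR]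
  have hQ₀0 : ((7 : ℕ) : ℤ) • Q₀ ≠ 0 := by
    rw [h5Q₀, Ne, ← (baseExt _ L).map_zero, (baseExt_injective _ L).eq_iff]
    exact h49' 0 (zsmul_zero _)
  have hQ₀T : ((7 : ℕ) : ℤ) • Q₀ ≠ baseExt (kubertTateSeven (m : ℚ) (n : ℚ)) L T₀ := by
    rw [h5Q₀, Ne, (baseExt_injective _ L).eq_iff]
    exact h49' T₀ hT
  have hQ₀negT : ((7 : ℕ) : ℤ) • Q₀ ≠ -baseExt (kubertTateSeven (m : ℚ) (n : ℚ)) L T₀ := by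
    rw [h5Q₀, ← map_neg, Ne, (baseExt_injective _ L).eq_iff]
    exact h49' (-T₀) (by rw [zsmul_neg, hT, neg_zero])
  -- the Kummer function on `E_L` and its value at `5Q₀ = ι_*(x₀, y₀)`
  obtain ⟨fL, hfL0, hfLord, hfLval⟩ := exists_kummerFn m n L hT00
  have hfLord' : ∀ Q : geomPoints ((kubertTateSeven (m : ℚ) (n : ℚ)).baseChange L),
      ord (((kubertTateSeven (m : ℚ) (n : ℚ)).baseChange L).baseChange (AlgebraicClosure L)).toAffine Q fL =
        ((7 : ℕ) : ℤ) * ((if Q = baseExt (kubertTateSeven (m : ℚ) (n : ℚ)) L T₀ then 1 else 0) -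
          (if Q = 0 then 1 else 0)) := by
    intro Q; rw [hfLord Q, eTL]
  obtain ⟨h₀'', e₀⟩ := baseExt_some_algebraMap m n L h₀'
  have ha₀ : ((kubertTateSeven (m : ℚ) (n : ℚ)).baseChange L).HasValueAt fL (((7 : ℕ) : ℤ) • Q₀)
      (algebraMap L (AlgebraicClosure L) (algebraMap ℚ L (x₀ ^ 2 * y₀ - n * (m + n) * x₀ ^ 3 + (n : ℚ) ^ 3 * (2 * m + n) * x₀ * y₀ - m ^ 2 * (n : ℚ) ^ 4 * x₀ ^ 2 + m ^ 2 * (n : ℚ) ^ 6 * y₀))) := by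
    rw [h5Q₀, e₅, e₀]
    refine (hfLval _ _ h₀'').congr rfl ?_
    rw [← IsScalarTower.algebraMap_apply ℚ L (AlgebraicClosure L)]
    simp only [map_sub, map_add, map_mul, map_pow, map_intCast, map_ofNat]
  -- case `P = ψ_L Q' = O`
  by_cases hP0 : ψL Q' = 0
  · obtain ⟨k, u, hk, hu0, hu⟩ := exists_pow_eq_pow_of_psi_eq_zero φ ψ hψ T₀ hT hT0 hTfix hker L φL ψL
      hφL' hψL' hφLcard' c hQ' hP0 hαp hcα
    exact ⟨k, u, 0, 0, x₀, y₀, hk, hu0, Or.inl hu⟩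
  -- otherwise translate `Q'` by `X ∈ {O, φ_L Q₀}` so that `ψ_L(Q' + X) ∉ {O, T_L}`
  obtain ⟨X, hXfix, hP0', hPT'⟩ : ∃ X : geomPoints ((kubertTateSeven' (m : ℚ) (n : ℚ)).baseChange L),
      (∀ τ : absoluteGaloisGroup L, τ • X = X) ∧ ψL (Q' + X) ≠ 0 ∧ ψL (Q' + X) ≠ baseExt (kubertTateSeven (m : ℚ) (n : ℚ)) L T₀ := by
    by_cases hPT : ψL Q' = baseExt (kubertTateSeven (m : ℚ) (n : ℚ)) L T₀
    · refine ⟨φL Q₀, fun τ ↦ by rw [← Isogeny.map_smul, hQ₀fix], ?_, ?_⟩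
      · rw [map_add, hLp, hPT]
        exact fun h0 ↦ hQ₀negT (eq_neg_of_add_eq_zero_right h0)
      · rw [map_add, hLp, hPT]
        exact fun h0 ↦ hQ₀0 (add_eq_left.mp h0)
    · exact ⟨0, fun τ ↦ smul_zero τ, by rwa [add_zero], by rwa [add_zero]⟩
  have hc' : ∀ τ : absoluteGaloisGroup L,
      (((Isogeny.resCocycle ψ L ψL hψL' c).1 τ : ψL.toAddMonoidHom.ker) : geomPoints ((kubertTateSeven' (m : ℚ) (n : ℚ)).baseChange L)) =
        τ • (Q' + X) - (Q' + X) := fun τ ↦ by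
    rw [hQ' τ, smul_add, hXfix τ]; abel
  -- the point `P = ψ_L(Q' + X)` is `L`-rational: `P = (x, y)`
  have hPfix : ∀ τ : absoluteGaloisGroup L, τ • ψL (Q' + X) = ψL (Q' + X) :=
    smul_psi_eq_of_coboundary ψL (Isogeny.resCocycle ψ L ψL hψL' c) hc'
  obtain ⟨x, y, hxy, hxy', ePxy⟩ := exists_eq_some_of_fixed m n L hPfix hP0'
  have hb : ((kubertTateSeven (m : ℚ) (n : ℚ)).baseChange L).HasValueAt fL (ψL (Q' + X))
      (algebraMap L (AlgebraicClosure L) (x ^ 2 * y - n * (m + n) * x ^ 3 + (n : L) ^ 3 * (2 * m + n) * x * y - m ^ 2 * (n : L) ^ 4 * x ^ 2 + m ^ 2 * (n : L) ^ 6 * y)) := by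
    rw [ePxy]
    refine (hfLval _ _ hxy').congr rfl ?_
    simp only [map_sub, map_add, map_mul, map_pow, map_intCast, map_ofNat]
  -- the Kummer invariant is the descent value
  obtain ⟨k, u, hk, hu0, hu⟩ := exists_pow_mul_pow_eq_value_of_coboundary φ ψ hψ T₀ hT hT0 hTfix hker L φL ψL
    hφL' hψL' hφLcard' hfL0 hfLord' c hc' hP0' hPT' hb hQ₀0 hQ₀T hQ₀fix ha₀ hαp hcα
  refine ⟨k, u, x, y, x₀, y₀, hk, hu0, Or.inr ⟨⟨?_, ?_⟩, ⟨he₀, hT₅⟩, ?_⟩⟩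
  · exact (equation_iff m n L x y).mp hxy.left
  · rintro ⟨rfl, rfl⟩
    apply hPT'
    rw [ePxy, eTL]
    exact some_eq_some_of_eq (map_zero _) (map_zero _) _ _
  · exact (algebraMap L (AlgebraicClosure L)).injective (by rw [map_mul]; exact hu)

end Local

/-! ## §2 Over `ℚ_q`, `q ∤ mn(m − n)`: the valuation of the Kummer invariant is divisible by `7` -/

section Padic

variable (q : ℕ) [Fact q.Prime]

/-- `‖x‖ = ‖z‖⁷ ⟹ v_q(x) = 7 v_q(z)` in `ℚ_q` (for `x, z ≠ 0`). [folklore] -/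
private theorem valuation_eq_seven_mul_of_norm_eq {x z : ℚ_[q]} (hx : x ≠ 0) (hz : z ≠ 0)
    (h : ‖x‖ = ‖z‖ ^ 7) : x.valuation = 7 * z.valuation := by
  have hq : (1 : ℝ) < q := by exact_mod_cast (Fact.out : q.Prime).one_lt
  rw [Padic.norm_eq_zpow_neg_valuation hx, Padic.norm_eq_zpow_neg_valuation hz, ← zpow_natCast, ← zpow_mul] at h
  have := zpow_right_injective₀ (zero_lt_one.trans hq) hq.ne' h
  push_cast at this
  linarith

omit hE in
/-- In `ℚ_q` with `q ∤ mn(m − n)`: **`v_q(f_T(x, y)) ∈ 7ℤ`** for every `ℚ_q`-point `(x, y) ≠ T` of `E_{m,n}` (the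
tree's valuation lemma `KubertTateSevenKummer.exists_val_kummerFn₇_eq_pow` at the `q`-adic norm, `m, n, m − n`
being `q`-units).
[cite: SilvermanAEC2009, Exercise 10.1(c)] -/
theorem valuation_kummerFn_eq_seven_mul (hqm : ¬ (q : ℤ) ∣ m) (hqn : ¬ (q : ℤ) ∣ n)
    (hqmn : ¬ (q : ℤ) ∣ (m - n)) {x y : ℚ_[q]}
    (he : y ^ 2 + ((n : ℚ_[q]) ^ 2 + m * n - m ^ 2) * x * y + m ^ 2 * (n : ℚ_[q]) ^ 3 * (n - m) * y = x ^ 3 + m ^ 2 * n * (n - m) * x ^ 2) (hT : ¬ (x = 0 ∧ y = 0)) :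
    x ^ 2 * y - n * (m + n) * x ^ 3 + (n : ℚ_[q]) ^ 3 * (2 * m + n) * x * y - m ^ 2 * (n : ℚ_[q]) ^ 4 * x ^ 2 + m ^ 2 * (n : ℚ_[q]) ^ 6 * y ≠ 0 ∧
      ∃ z : ℚ_[q], z ≠ 0 ∧ (x ^ 2 * y - n * (m + n) * x ^ 3 + (n : ℚ_[q]) ^ 3 * (2 * m + n) * x * y - m ^ 2 * (n : ℚ_[q]) ^ 4 * x ^ 2 + m ^ 2 * (n : ℚ_[q]) ^ 6 * y).valuation = 7 * z.valuation := by
  set w : Valuation ℚ_[q] ℝ≥0 := NormedField.valuation with hw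
  have hint : ∀ {z : ℤ}, ¬ (q : ℤ) ∣ z → w (z : ℚ_[q]) = 1 := fun {z} hz ↦ by
    rw [hw, NormedField.valuation_apply, ← NNReal.coe_inj, coe_nnnorm, NNReal.coe_one]
    have hle := Padic.norm_int_le_one (p := q) z
    by_contra hne
    exact hz ((Padic.norm_intCast_lt_one_iff (p := q)).mp (lt_of_le_of_ne hle hne))
  have hmn : w ((m : ℚ_[q]) - (n : ℚ_[q])) = 1 := by
    have h := hint hqmn
    push_cast at h
    exact h
  obtain ⟨z, hz0, hz⟩ := KubertTateSevenKummer.exists_val_kummerFn₇_eq_pow w (hint hqm) (hint hqn) hmn he hT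
  have hF0 : x ^ 2 * y - n * (m + n) * x ^ 3 + (n : ℚ_[q]) ^ 3 * (2 * m + n) * x * y - m ^ 2 * (n : ℚ_[q]) ^ 4 * x ^ 2 + m ^ 2 * (n : ℚ_[q]) ^ 6 * y ≠ 0 := by
    intro h0
    rw [h0, map_zero, eq_comm, pow_eq_zero_iff (by norm_num : 7 ≠ 0), map_eq_zero] at hz
    exact hz0 hz
  have hnorm : ‖x ^ 2 * y - n * (m + n) * x ^ 3 + (n : ℚ_[q]) ^ 3 * (2 * m + n) * x * y - m ^ 2 * (n : ℚ_[q]) ^ 4 * x ^ 2 + m ^ 2 * (n : ℚ_[q]) ^ 6 * y‖ = ‖z‖ ^ 7 := by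
    have := congrArg (fun t : ℝ≥0 ↦ (t : ℝ)) hz
    simpa [hw, NormedField.valuation_apply] using this
  exact ⟨hF0, z, hz0, valuation_eq_seven_mul_of_norm_eq q hF0 hz0 hnorm⟩

omit hE in
/-- **`7 ∣ v_q(a)` from the local reading at `ℚ_q`**, `q ∤ mn(m − n)`: if `aᵏ = u⁷`, or
`aᵏ u⁷ f_T(x₀, y₀) = f_T(x, y)` at `ℚ_q`-points `(x, y), (x₀, y₀) ≠ T` of `E` (both values have valuation in
`7ℤ`), with `7 ∤ k`.
[cite: SilvermanAEC2009, Exercise 10.1(c)] [cite: Fisher2001FiveSevenDescent, §2] -/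
theorem seven_dvd_padicValRat_of_kummer_local (hqm : ¬ (q : ℤ) ∣ m) (hqn : ¬ (q : ℤ) ∣ n)
    (hqmn : ¬ (q : ℤ) ∣ (m - n)) {a : ℚ} (ha : a ≠ 0)
    {k : ℕ} {u x y x₀ y₀ : ℚ_[q]} (hk : ¬ 7 ∣ k) (hu : u ≠ 0)
    (h : (a : ℚ_[q]) ^ k = u ^ 7 ∨
      ((y ^ 2 + ((n : ℚ_[q]) ^ 2 + m * n - m ^ 2) * x * y + m ^ 2 * (n : ℚ_[q]) ^ 3 * (n - m) * y = x ^ 3 + m ^ 2 * n * (n - m) * x ^ 2 ∧ ¬ (x = 0 ∧ y = 0)) ∧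
       (y₀ ^ 2 + ((n : ℚ_[q]) ^ 2 + m * n - m ^ 2) * x₀ * y₀ + m ^ 2 * (n : ℚ_[q]) ^ 3 * (n - m) * y₀ = x₀ ^ 3 + m ^ 2 * n * (n - m) * x₀ ^ 2 ∧ ¬ (x₀ = 0 ∧ y₀ = 0)) ∧
        (a : ℚ_[q]) ^ k * u ^ 7 * (x₀ ^ 2 * y₀ - n * (m + n) * x₀ ^ 3 + (n : ℚ_[q]) ^ 3 * (2 * m + n) * x₀ * y₀ - m ^ 2 * (n : ℚ_[q]) ^ 4 * x₀ ^ 2 + m ^ 2 * (n : ℚ_[q]) ^ 6 * y₀) =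
          x ^ 2 * y - n * (m + n) * x ^ 3 + (n : ℚ_[q]) ^ 3 * (2 * m + n) * x * y - m ^ 2 * (n : ℚ_[q]) ^ 4 * x ^ 2 + m ^ 2 * (n : ℚ_[q]) ^ 6 * y)) :
    (7 : ℤ) ∣ padicValRat q a := by
  have ha' : (a : ℚ_[q]) ≠ 0 := by exact_mod_cast ha
  have hcop : IsCoprime (7 : ℤ) (k : ℤ) := by
    have h5 : IsCoprime ((7 : ℕ) : ℤ) (k : ℤ) :=
      Nat.isCoprime_iff_coprime.mpr ((Nat.Prime.coprime_iff_not_dvd prime_seven').mpr hk)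
    exact_mod_cast h5
  -- `k · v_q(a) ∈ 5ℤ` suffices
  suffices hkv : (7 : ℤ) ∣ (k : ℤ) * padicValRat q a by
    rw [mul_comm] at hkv
    exact hcop.dvd_of_dvd_mul_right hkv
  rw [← Padic.valuation_ratCast, ← Padic.valuation_pow]
  rcases h with h | ⟨⟨he, hT⟩, ⟨he₀, hT₀⟩, h⟩
  · rw [h, Padic.valuation_pow]
    exact ⟨u.valuation, by push_cast; ring⟩
  · obtain ⟨hF0, z, hz0, hval⟩ := valuation_kummerFn_eq_seven_mul m n q hqm hqn hqmn he hT
    obtain ⟨hF₀0, z₀, hz₀0, hval₀⟩ := valuation_kummerFn_eq_seven_mul m n q hqm hqn hqmn he₀ hT₀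
    rw [← h, Padic.valuation_mul (mul_ne_zero (pow_ne_zero _ ha') (pow_ne_zero _ hu)) hF₀0,
      Padic.valuation_mul (pow_ne_zero _ ha') (pow_ne_zero _ hu), Padic.valuation_pow, Padic.valuation_pow, hval₀] at hval
    rw [Padic.valuation_pow]
    exact ⟨z.valuation - u.valuation - z₀.valuation, by push_cast at hval ⊢; linarith⟩

end Padic

/-! ## §3 The Selmer condition at every finite place: `7 ∣ v_q` of the Kummer invariant for `q ∤ mn(m − n)`, and the count -/

omit hE in
/-- Transport of the local reading along `ℚ_v ≃ₐ[ℚ] ℚ_q` (Mathlib `Rat.HeightOneSpectrum.adicCompletion.padicEquiv`).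
[folklore] -/
private theorem kummer_local_transport {L L' : Type*} [Field L] [Algebra ℚ L] [Field L'] [Algebra ℚ L']
    (e : L ≃ₐ[ℚ] L') {a : ℚ} {k : ℕ} {u x y : L} {x₀ y₀ : ℚ} (hu : u ≠ 0)
    (h : (algebraMap ℚ L a) ^ k = u ^ 7 ∨
      ((y ^ 2 + ((n : L) ^ 2 + m * n - m ^ 2) * x * y + m ^ 2 * (n : L) ^ 3 * (n - m) * y = x ^ 3 + m ^ 2 * n * (n - m) * x ^ 2 ∧ ¬ (x = 0 ∧ y = 0)) ∧
       (y₀ ^ 2 + ((n : ℚ) ^ 2 + m * n - m ^ 2) * x₀ * y₀ + m ^ 2 * (n : ℚ) ^ 3 * (n - m) * y₀ = x₀ ^ 3 + m ^ 2 * n * (n - m) * x₀ ^ 2 ∧ ¬ (x₀ = 0 ∧ y₀ = 0)) ∧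
        (algebraMap ℚ L a) ^ k * u ^ 7 * algebraMap ℚ L (x₀ ^ 2 * y₀ - n * (m + n) * x₀ ^ 3 + (n : ℚ) ^ 3 * (2 * m + n) * x₀ * y₀ - m ^ 2 * (n : ℚ) ^ 4 * x₀ ^ 2 + m ^ 2 * (n : ℚ) ^ 6 * y₀) =
          x ^ 2 * y - n * (m + n) * x ^ 3 + (n : L) ^ 3 * (2 * m + n) * x * y - m ^ 2 * (n : L) ^ 4 * x ^ 2 + m ^ 2 * (n : L) ^ 6 * y)) :
    ∃ u' x' y' : L', u' ≠ 0 ∧ ((algebraMap ℚ L' a) ^ k = u' ^ 7 ∨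
      ((y' ^ 2 + ((n : L') ^ 2 + m * n - m ^ 2) * x' * y' + m ^ 2 * (n : L') ^ 3 * (n - m) * y' = x' ^ 3 + m ^ 2 * n * (n - m) * x' ^ 2 ∧ ¬ (x' = 0 ∧ y' = 0)) ∧
       (y₀ ^ 2 + ((n : ℚ) ^ 2 + m * n - m ^ 2) * x₀ * y₀ + m ^ 2 * (n : ℚ) ^ 3 * (n - m) * y₀ = x₀ ^ 3 + m ^ 2 * n * (n - m) * x₀ ^ 2 ∧ ¬ (x₀ = 0 ∧ y₀ = 0)) ∧
        (algebraMap ℚ L' a) ^ k * u' ^ 7 * algebraMap ℚ L' (x₀ ^ 2 * y₀ - n * (m + n) * x₀ ^ 3 + (n : ℚ) ^ 3 * (2 * m + n) * x₀ * y₀ - m ^ 2 * (n : ℚ) ^ 4 * x₀ ^ 2 + m ^ 2 * (n : ℚ) ^ 6 * y₀) =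
          x' ^ 2 * y' - n * (m + n) * x' ^ 3 + (n : L') ^ 3 * (2 * m + n) * x' * y' - m ^ 2 * (n : L') ^ 4 * x' ^ 2 + m ^ 2 * (n : L') ^ 6 * y')) := by
  have hea : ∀ r : ℚ, e (algebraMap ℚ L r) = algebraMap ℚ L' r := e.commutes
  refine ⟨e u, e x, e y, (map_ne_zero e).mpr hu, ?_⟩
  rcases h with h | ⟨⟨he, hT⟩, h₀, h⟩
  · left
    have := congrArg e h
    simpa [map_pow, hea] using this
  · right
    refine ⟨⟨?_, ?_⟩, h₀, ?_⟩
    · have := congrArg e he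
      simpa [map_pow, map_mul, map_sub, map_add, map_intCast, map_ofNat] using this
    · rintro ⟨hx, hy⟩
      exact hT ⟨(map_eq_zero e).mp hx, (map_eq_zero e).mp hy⟩
    · have := congrArg e h
      simpa [map_pow, map_mul, map_sub, map_add, map_intCast, map_ofNat, hea] using this

include hP₁ h49 in
/-- **`7 ∣ v_q(a)` for every prime `q ∤ mn(m − n)`** when `(α, a)` is a Kummer generator of a cocycle `c` whose class
lies in the `ψ`-Selmer group (local condition at the place `v ↔ q`, read via `kummer_local` at `ℚ_v` and
`seven_dvd_padicValRat_of_kummer_local` at `ℚ_q ≅ ℚ_v`). [cite: SilvermanAEC2009, Thm. X.4.2 and Prop. X.4.9]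
[cite: Fisher2001FiveSevenDescent, §2] -/
theorem seven_dvd_padicValRat_of_generator
    (c : letI := ψ.kerAction
      contOneCocycles (discreteTopRep (absoluteGaloisGroup ℚ) ψ.toAddMonoidHom.ker))
    (hsel : letI := ψ.kerAction
      oneCocycleClass _ c ∈ ψ.selmerGroup)
    {α : (AlgebraicClosure ℚ)ˣ} {a : ℚˣ}
    (hαp : α ^ 7 = Units.map (algebraMap ℚ (AlgebraicClosure ℚ) : ℚ →* AlgebraicClosure ℚ) a)
    (hcα : ∀ σ : absoluteGaloisGroup ℚ, muVal ℚ 7 (dualKerChar (sevenIsogeny (m : ℚ) (n : ℚ)) ψ hψ (Tbar (m : ℚ) (n : ℚ))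
      (seven_zsmul_Tbar (m : ℚ) (n : ℚ)) (ker_sevenIsogeny_eq_zmultiples (m : ℚ) (n : ℚ)) (c.1 σ)) = σ • α / α)
    (q : ℕ) [Fact q.Prime] (hqm : ¬ (q : ℤ) ∣ m) (hqn : ¬ (q : ℤ) ∣ n) (hqmn : ¬ (q : ℤ) ∣ (m - n)) :
    (7 : ℤ) ∣ padicValRat q (a : ℚ) := by
  letI := ψ.kerAction
  -- every prime is `primesEquiv v` for a finite place `v` of `𝓞 ℚ`
  have key : ∀ v : HeightOneSpectrum (𝓞 ℚ), (Rat.HeightOneSpectrum.primesEquiv v).1 = q →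
      (7 : ℤ) ∣ padicValRat q (a : ℚ) := by
    intro v hv
    set L := v.adicCompletion ℚ
    haveI : CharZero L := charZero_of_injective_algebraMap (algebraMap ℚ L).injective
    have hloc := ((ψ.mem_selmerGroup_iff _).mp hsel).1 v
    obtain ⟨k, u, x, y, x₀, y₀, hk, hu, h⟩ := kummer_local m n ψ hψ P₁ hP₁ h49 L c hloc hαp hcα
    haveI : Fact (Nat.Prime (Rat.HeightOneSpectrum.primesEquiv (R := 𝓞 ℚ) v).1) :=
      ⟨(Rat.HeightOneSpectrum.primesEquiv v).2⟩
    -- the `ℚ`-algebra structure of `ℚ_q` (Mathlib's `DivisionRing.toRatAlgebra`, disabled in this file)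
    letI : Algebra ℚ ℚ_[(Rat.HeightOneSpectrum.primesEquiv (R := 𝓞 ℚ) v).1] := DivisionRing.toRatAlgebra
    have e := (Rat.HeightOneSpectrum.adicCompletion.padicEquiv (R := 𝓞 ℚ) v).toAlgEquiv
    obtain ⟨u', x', y', hu', h'⟩ := kummer_local_transport m n e hu h
    subst hv
    refine seven_dvd_padicValRat_of_kummer_local m n _ hqm hqn hqmn a.ne_zero (u := u') (x := x') (y := y')
      (x₀ := (x₀ : ℚ_[(Rat.HeightOneSpectrum.primesEquiv (R := 𝓞 ℚ) v).1]))
      (y₀ := (y₀ : ℚ_[(Rat.HeightOneSpectrum.primesEquiv (R := 𝓞 ℚ) v).1])) hk hu' ?_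
    rcases h' with h' | ⟨h₁, ⟨he₀, hT₀⟩, h'⟩
    · left; simpa only [eq_ratCast] using h'
    · right
      refine ⟨h₁, ⟨by exact_mod_cast he₀, by exact_mod_cast hT₀⟩, ?_⟩
      have h'' := h'
      simp only [eq_ratCast] at h''
      push_cast at h'' ⊢
      exact h''
  have h2 := key ((Rat.HeightOneSpectrum.primesEquiv (R := 𝓞 ℚ)).symm ⟨q, Fact.out⟩)
  rw [Equiv.apply_symm_apply] at h2
  exact h2 rfl

include hP₁ h49 in
/-- **Every representative `a` of the Kummer invariant of a `ψ`-Selmer class has `7 ∣ v_q(a)` for all primes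
`q ∤ mn(m − n)`.** [cite: SilvermanAEC2009, Thm. X.4.2 and Prop. X.4.9] [cite: Fisher2001FiveSevenDescent, §2] -/
theorem seven_dvd_padicValRat_of_mem_selmerGroup {ξ : ψ.galH1Ker} (hξ : ξ ∈ ψ.selmerGroup) {a : ℚˣ}
    (ha : kummerInvariant (sevenIsogeny (m : ℚ) (n : ℚ)) ψ hψ (Tbar (m : ℚ) (n : ℚ)) (seven_zsmul_Tbar (m : ℚ) (n : ℚ))
      (smul_Tbar (m : ℚ) (n : ℚ)) (ker_sevenIsogeny_eq_zmultiples (m : ℚ) (n : ℚ)) ξ = Additive.ofMul (QuotientGroup.mk a))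
    (q : ℕ) [Fact q.Prime] (hqm : ¬ (q : ℤ) ∣ m) (hqn : ¬ (q : ℤ) ∣ n) (hqmn : ¬ (q : ℤ) ∣ (m - n)) :
    (7 : ℤ) ∣ padicValRat q (a : ℚ) := by
  letI := ψ.kerAction
  obtain ⟨c, rfl⟩ := oneCocycleClass_surjective _ ξ
  obtain ⟨α, a₀, hαp, hcα⟩ := exists_root_of_cocycle (sevenIsogeny (m : ℚ) (n : ℚ)) ψ hψ (Tbar (m : ℚ) (n : ℚ))
    (seven_zsmul_Tbar (m : ℚ) (n : ℚ)) (smul_Tbar (m : ℚ) (n : ℚ)) (ker_sevenIsogeny_eq_zmultiples (m : ℚ) (n : ℚ)) c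
  have h0 := seven_dvd_padicValRat_of_generator m n ψ hψ P₁ hP₁ h49 c hξ hαp hcα q hqm hqn hqmn
  -- `a ≡ a₀ (mod ℚˣ⁵)`
  have hinv := kummerInvariant_oneCocycleClass_eq_of_root (sevenIsogeny (m : ℚ) (n : ℚ)) ψ hψ (Tbar (m : ℚ) (n : ℚ))
    (seven_zsmul_Tbar (m : ℚ) (n : ℚ)) (smul_Tbar (m : ℚ) (n : ℚ)) (ker_sevenIsogeny_eq_zmultiples (m : ℚ) (n : ℚ)) c hαp hcα
  rw [ha] at hinv
  have hq' : (QuotientGroup.mk a : ℚˣ ⧸ (powMonoidHom 7 : ℚˣ →* ℚˣ).range) = QuotientGroup.mk a₀ :=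
    Additive.ofMul.injective hinv
  rw [QuotientGroup.eq] at hq'
  obtain ⟨w, hw⟩ := hq'
  have haw : (a₀ : ℚ) = a * (w : ℚ) ^ 7 := by
    have := congrArg (fun z : ℚˣ ↦ (z : ℚ)) hw
    simp only [powMonoidHom_apply, Units.val_mul, Units.val_pow_eq_pow_val, Units.val_inv_eq_inv_val] at this
    field_simp at this
    linear_combination -this
  have hv : padicValRat q (a₀ : ℚ) = padicValRat q (a : ℚ) + 7 * padicValRat q (w : ℚ) := by
    rw [haw, padicValRat.mul a.ne_zero (pow_ne_zero _ w.ne_zero), padicValRat.pow]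
    push_cast; ring
  obtain ⟨r, hr⟩ := h0
  exact ⟨r - padicValRat q (w : ℚ), by linarith⟩

include hψ hP₁ h49 in
/-- **`#Sel^ψ(E'/ℚ) ≤ 7 ^ ω(mn(m−n))`.** The injective Kummer invariant (`kummerInvariant_injective`) followed by
`a ↦ (v_q(a) mod 7)_{q ∣ mn(m−n)}` is injective on the Selmer group: two Selmer classes with the same exponents at
the primes of `mn(m − n)` differ by a class all of whose valuations are divisible by `7`, i.e. a seventh power (tree
`X1Eleven.exists_eq_pow_of_forall_dvd_padicValRat`). [cite: SilvermanAEC2009, Prop. X.4.9 and Exercise 10.1(c)]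
[cite: Fisher2001FiveSevenDescent, §2] -/
theorem natCard_selmerGroup_dual_le : Nat.card ψ.selmerGroup ≤ 7 ^ (m * n * (m - n)).natAbs.primeFactors.card := by
  letI := ψ.kerAction
  set S := (m * n * (m - n)).natAbs.primeFactors with hS
  set Κ := kummerInvariant (sevenIsogeny (m : ℚ) (n : ℚ)) ψ hψ (Tbar (m : ℚ) (n : ℚ)) (seven_zsmul_Tbar (m : ℚ) (n : ℚ))
    (smul_Tbar (m : ℚ) (n : ℚ)) (ker_sevenIsogeny_eq_zmultiples (m : ℚ) (n : ℚ)) with hΚ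
  have hΚinj : Function.Injective Κ := kummerInvariant_injective _ _ _ _ _ (Tbar_ne_zero (m : ℚ) (n : ℚ)) _ _
  obtain ⟨hm0, hn0, hmn0, -⟩ := ne_zero_of_isElliptic (m : ℚ) (n : ℚ)
  have hm0' : m ≠ 0 := by exact_mod_cast hm0
  have hn0' : n ≠ 0 := by exact_mod_cast hn0
  have hmn0' : m - n ≠ 0 := by
    intro h; apply hmn0; exact_mod_cast (sub_eq_zero.mp h)
  -- primes off `S` do not divide `m`, `n`, `m - n`
  have hoff : ∀ q : ℕ, q.Prime → q ∉ S → ¬ (q : ℤ) ∣ m ∧ ¬ (q : ℤ) ∣ n ∧ ¬ (q : ℤ) ∣ (m - n) := by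
    intro q hq hqS
    have hnd : ¬ q ∣ (m * n * (m - n)).natAbs := fun hd ↦ hqS (by
      rw [hS, Nat.mem_primeFactors]
      exact ⟨hq, hd, Int.natAbs_ne_zero.mpr (mul_ne_zero (mul_ne_zero hm0' hn0') hmn0')⟩)
    have hnd' : ¬ (q : ℤ) ∣ m * n * (m - n) := fun hd ↦ hnd (by simpa using Int.natAbs_dvd_natAbs.mpr hd)
    exact ⟨fun hd ↦ hnd' ((hd.mul_right n).mul_right (m - n)),
      fun hd ↦ hnd' ((dvd_mul_of_dvd_right hd m).mul_right (m - n)),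
      fun hd ↦ hnd' (dvd_mul_of_dvd_right hd (m * n))⟩
  -- a representative in `ℚˣ` of the invariant of each class
  have hrep : ∀ ξ : ψ.galH1Ker, ∃ a : ℚˣ, Κ ξ = Additive.ofMul (QuotientGroup.mk a) := fun ξ ↦ by
    obtain ⟨a, ha⟩ := QuotientGroup.mk_surjective (Additive.toMul (Κ ξ))
    exact ⟨a, by rw [ha]; rfl⟩
  choose rep hrep using hrep
  let g : ψ.selmerGroup → (S → ZMod 7) := fun ξ q ↦ (padicValRat q (rep ξ : ℚ) : ZMod 7)
  have hg : Function.Injective g := by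
    intro ξ ξ' hgg
    -- the quotient `a/a'` represents `Κ (ξ - ξ')`
    have hdiff : Κ ((ξ : ψ.galH1Ker) - ξ') = Additive.ofMul (QuotientGroup.mk (rep ξ / rep ξ')) := by
      rw [map_sub, hrep, hrep, QuotientGroup.mk_div, ofMul_div]
    have hmem : ((ξ : ψ.galH1Ker) - ξ') ∈ ψ.selmerGroup := ψ.selmerGroup.sub_mem ξ.2 ξ'.2
    have hall : ∀ q : ℕ, q.Prime → (7 : ℤ) ∣ padicValRat q ((rep ξ / rep ξ' : ℚˣ) : ℚ) := by
      intro q hq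
      haveI : Fact q.Prime := ⟨hq⟩
      have hdiv : ((rep ξ / rep ξ' : ℚˣ) : ℚ) = (rep ξ : ℚ) / (rep ξ' : ℚ) := Units.val_div_eq_div_val _ _
      by_cases hqS : q ∈ S
      · have hq' := congrFun hgg ⟨q, hqS⟩
        simp only [g] at hq'
        rw [hdiv, padicValRat.div (rep ξ).ne_zero (rep ξ').ne_zero]
        exact (ZMod.intCast_eq_intCast_iff_dvd_sub _ _ 7).mp hq'.symm
      · obtain ⟨hqm, hqn, hqmn⟩ := hoff q hq hqS
        exact seven_dvd_padicValRat_of_mem_selmerGroup m n ψ hψ P₁ hP₁ h49 hmem hdiff q hqm hqn hqmn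
    obtain ⟨w, hw0, hw⟩ := X1Eleven.exists_eq_pow_of_forall_dvd_padicValRat (rep ξ / rep ξ').ne_zero
      (by decide : Odd 7) hall
    have h1 : (QuotientGroup.mk (rep ξ / rep ξ') : ℚˣ ⧸ (powMonoidHom 7 : ℚˣ →* ℚˣ).range) = 1 := by
      rw [QuotientGroup.eq_one_iff]
      exact ⟨Units.mk0 w hw0, Units.ext (by rw [powMonoidHom_apply, Units.val_pow_eq_pow_val, Units.val_mk0, ← hw])⟩
    rw [h1, ofMul_one] at hdiff
    have h0 : (ξ : ψ.galH1Ker) - ξ' = 0 := hΚinj (by rw [hdiff, map_zero])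
    exact Subtype.ext (sub_eq_zero.mp h0)
  have hcard := Nat.card_le_card_of_injective g hg
  have hfun : Nat.card (S → ZMod 7) = 7 ^ S.card := by
    rw [Nat.card_fun, Nat.card_eq_fintype_card (α := ZMod 7), ZMod.card, Nat.card_eq_fintype_card,
      Fintype.card_coe]
  rw [hfun] at hcard
  exact hcard

/-! ## §4 The tame régime: `#Sel^ψ = #(E(ℚ)/7E(ℚ)) · #ker Ш(ψ)`, `rank ≤ ω(mn(m−n)) − 1`, and `Ш[7] = 0` when the box is full -/

section Tame

/- The generic isogeny library carries `E(ℚ)` with the classical `DecidableEq ℚ` (as does this section);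
a consumer holding a point count for the computable instance converts it along `Subsingleton.elim`
(`have h : (instDecidableEqRat : DecidableEq ℚ) = fun a b ↦ Classical.propDecidable _ := Subsingleton.elim _ _`). -/
attribute [local instance 10000] Classical.propDecidable

variable (h7 : ¬ (7 : ℤ) ∣ (kubertTateSeven m n).Δ)
  (h1 : ∀ p : ℕ, p.Prime → (p : ℤ) ∣ (kubertTateSeven m n).Δ → p % 7 ≠ 1)

include hψ h7 h1 in
/-- **`ψ(E'(ℚ)) = 7E(ℚ)` in the tame régime**: `E'(ℚ) = φ(E(ℚ))` (`Sel^φ = 0`, tree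
`KubertTateSevenVelu.selmerGroup_sevenIsogeny_eq_bot`) and `ψ ∘ φ = [7]`. [cite: SilvermanAEC2009, Thm. X.4.2(a)]
[cite: Mazur1977, Ch. III §3 Thm. (3.1)] -/
theorem range_pointHom_dual_eq
    (g : (kubertTateSeven' (m : ℚ) (n : ℚ)).toAffine.Point →+ (kubertTateSeven (m : ℚ) (n : ℚ)).toAffine.Point)
    (hg : ∀ P', toGeomPoints _ (g P') = ψ (toGeomPoints _ P')) :
    g.range = (nsmulAddMonoidHom (7 : ℕ) :
      (kubertTateSeven (m : ℚ) (n : ℚ)).toAffine.Point →+ (kubertTateSeven (m : ℚ) (n : ℚ)).toAffine.Point).range := by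
  obtain ⟨f, hf⟩ := (sevenIsogeny (m : ℚ) (n : ℚ)).exists_pointHom
  have hgf : ∀ P : (kubertTateSeven (m : ℚ) (n : ℚ)).toAffine.Point, g (f P) = (7 : ℕ) • P := fun P ↦ by
    apply toGeomPoints_injective (kubertTateSeven (m : ℚ) (n : ℚ))
    rw [hg, hf, hψ, map_nsmul, natCast_zsmul]
  ext Q
  constructor
  · rintro ⟨P', rfl⟩
    obtain ⟨P, hP⟩ := ConstantKernelDescent.exists_toGeomPoints_eq_of_selmerGroup_eq_bot
      (sevenIsogeny (m : ℚ) (n : ℚ)) (KubertTateSevenVelu.selmerGroup_sevenIsogeny_eq_bot m n h7 h1) P'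
    have hP' : P' = f P := toGeomPoints_injective (kubertTateSeven' (m : ℚ) (n : ℚ)) (by rw [hP, hf])
    exact ⟨P, by rw [nsmulAddMonoidHom_apply, hP', hgf]⟩
  · rintro ⟨P, rfl⟩
    exact ⟨f P, by rw [nsmulAddMonoidHom_apply, hgf]⟩

include hψ h7 h1 in
/-- **`#Sel^ψ(E'/ℚ) = #(E(ℚ)/7E(ℚ)) · #ker Ш(ψ)` in the tame régime** (Silverman X.4.2(a) counted, tree
`Isogeny.natCard_selmerGroup_eq`, with `ψ(E'(ℚ)) = 7E(ℚ)`). [cite: SilvermanAEC2009, Thm. X.4.2(a)] -/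
theorem natCard_selmerGroup_dual_eq :
    Nat.card ψ.selmerGroup =
      Nat.card ((kubertTateSeven (m : ℚ) (n : ℚ)).toAffine.Point ⧸ (nsmulAddMonoidHom (7 : ℕ) :
        (kubertTateSeven (m : ℚ) (n : ℚ)).toAffine.Point →+ (kubertTateSeven (m : ℚ) (n : ℚ)).toAffine.Point).range) *
      Nat.card (shaMap ψ.toAddMonoidHom ψ.equivariant ψ.hasLocalPointsMaps_toAddMonoidHom).ker := by
  obtain ⟨g, hg⟩ := ψ.exists_pointHom
  rw [ψ.natCard_selmerGroup_eq g hg, range_pointHom_dual_eq m n ψ hψ h7 h1 g hg, AddSubgroup.index_eq_card]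

include hψ in
/-- `ker Ш(ψ)` is finite (it embeds in `Ш(E'/ℚ)[7]`, finite by weak Mordell–Weil; tree `finite_ker_shaMap`).
[cite: SilvermanAEC2009, Thm. X.4.2(b)] -/
private theorem finite_ker_shaMap_dual :
    Finite (shaMap ψ.toAddMonoidHom ψ.equivariant ψ.hasLocalPointsMaps_toAddMonoidHom).ker :=
  (finite_ker_shaMap ψ.toAddMonoidHom ψ.equivariant ψ.hasLocalPointsMaps_toAddMonoidHom
    (sevenIsogeny (m : ℚ) (n : ℚ)).toAddMonoidHom (sevenIsogeny (m : ℚ) (n : ℚ)).equivariant (n := 7) (by norm_num)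
    (fun Q ↦ by rw [Isogeny.coe_toAddMonoidHom, Isogeny.coe_toAddMonoidHom, comp_dual_eq m n ψ hψ Q])).to_subtype

include hψ hP₁ h49 h7 h1 in
/-- **`#(E(ℚ)/7E(ℚ)) ≤ 7 ^ ω(mn(m−n))` in the tame régime** (from `#Sel^ψ ≤ 7 ^ ω(mn(m−n))` and `#ker Ш(ψ) ≥ 1`).
[cite: SilvermanAEC2009, Thm. X.4.2 and Prop. X.4.9] [cite: Fisher2001FiveSevenDescent, §2] -/
theorem natCard_quotient_le :
    Nat.card ((kubertTateSeven (m : ℚ) (n : ℚ)).toAffine.Point ⧸ (nsmulAddMonoidHom (7 : ℕ) :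
        (kubertTateSeven (m : ℚ) (n : ℚ)).toAffine.Point →+ (kubertTateSeven (m : ℚ) (n : ℚ)).toAffine.Point).range) ≤
      7 ^ (m * n * (m - n)).natAbs.primeFactors.card := by
  haveI := finite_ker_shaMap_dual m n ψ hψ
  have h := natCard_selmerGroup_dual_le m n ψ hψ P₁ hP₁ h49
  rw [natCard_selmerGroup_dual_eq m n ψ hψ h7 h1] at h
  have hpos : 0 < Nat.card (shaMap ψ.toAddMonoidHom ψ.equivariant ψ.hasLocalPointsMaps_toAddMonoidHom).ker :=
    Nat.card_pos
  nlinarith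

include hψ hP₁ h49 h7 h1 in
/-- **`7 ^ (rank E_{m,n}(ℚ) + 1) ≤ 7 ^ ω(mn(m−n))`, i.e. `rank E_{m,n}(ℚ) ≤ ω(mn(m−n)) − 1`, in the tame régime**
(`#(E(ℚ)/7E(ℚ)) = 7^rank · #E(ℚ)[7]`, tree `natCard_quotient_nsmulRange_eq`, and `T ∈ E(ℚ)[7]` has order `7`).
[cite: SilvermanAEC2009, Thm. X.4.2 and Prop. X.4.9] [cite: Fisher2001FiveSevenDescent, §2] -/
theorem pow_mordellWeilRank_succ_le :
    7 ^ ((kubertTateSeven (m : ℚ) (n : ℚ)).mordellWeilRank + 1) ≤ 7 ^ (m * n * (m - n)).natAbs.primeFactors.card := by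
  haveI : Module.Finite ℤ (kubertTateSeven (m : ℚ) (n : ℚ)).toAffine.Point := by
    convert module_finite_point_holds (kubertTateSeven (m : ℚ) (n : ℚ))
  have hcard := natCard_quotient_nsmulRange_eq (kubertTateSeven (m : ℚ) (n : ℚ)).toAffine.Point 7
  have hle := natCard_quotient_le m n ψ hψ P₁ hP₁ h49 h7 h1
  rw [hcard] at hle
  -- `#E(ℚ)[7] ≥ 7`: the rational point `(0,0)` has order `7`
  obtain ⟨hm0, hn0, hmn0, -⟩ := ne_zero_of_isElliptic (m : ℚ) (n : ℚ)
  obtain ⟨T, hT⟩ := exists_addOrderOf_eq_seven_kubertTateSeven hm0 hn0 hmn0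
  have h7T : 7 ≤ Nat.card (AddSubgroup.torsionBy (kubertTateSeven (m : ℚ) (n : ℚ)).toAffine.Point ((7 : ℕ) : ℤ)) := by
    -- `E(ℚ)[7] ↪ E(ℚ̄)[7]`, finite
    haveI : Finite (AddSubgroup.torsionBy (kubertTateSeven (m : ℚ) (n : ℚ)).toAffine.Point ((7 : ℕ) : ℤ)) :=
      Literature.NumberTheory.EllipticCurves.finite_torsionBy_of_injective
        (toGeomPoints (kubertTateSeven (m : ℚ) (n : ℚ))) (toGeomPoints_injective _) _
        (WeierstrassCurve.finite_torsionBy_of_isAlgClosed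
          (V := (kubertTateSeven (m : ℚ) (n : ℚ)).baseChange (AlgebraicClosure ℚ)) (by norm_num))
    have hsub : AddSubgroup.zmultiples T ≤ AddSubgroup.torsionBy _ ((7 : ℕ) : ℤ) := by
      rw [AddSubgroup.zmultiples_le, mem_torsionBy_iff, natCast_zsmul, ← hT, addOrderOf_nsmul_eq_zero]
    have := AddSubgroup.card_le_of_le hsub
    rwa [Nat.card_zmultiples, hT] at this
  have hr : (kubertTateSeven (m : ℚ) (n : ℚ)).mordellWeilRank =
      Module.finrank ℤ (kubertTateSeven (m : ℚ) (n : ℚ)).toAffine.Point := by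
    unfold WeierstrassCurve.mordellWeilRank; congr!
  rw [hr, pow_succ]
  calc 7 ^ Module.finrank ℤ (kubertTateSeven (m : ℚ) (n : ℚ)).toAffine.Point * 7
      ≤ 7 ^ Module.finrank ℤ (kubertTateSeven (m : ℚ) (n : ℚ)).toAffine.Point *
          Nat.card (AddSubgroup.torsionBy (kubertTateSeven (m : ℚ) (n : ℚ)).toAffine.Point ((7 : ℕ) : ℤ)) :=
        Nat.mul_le_mul_left _ h7T
    _ ≤ 7 ^ (m * n * (m - n)).natAbs.primeFactors.card := hle

include hψ hP₁ h49 h7 h1 in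
/-- **`rank E_{m,n}(ℚ) + 1 ≤ ω(mn(m−n))` in the tame régime** (with a rational point of infinite order present).
[cite: SilvermanAEC2009, Thm. X.4.2 and Prop. X.4.9] [cite: Fisher2001FiveSevenDescent, §2] -/
theorem mordellWeilRank_succ_le :
    (kubertTateSeven (m : ℚ) (n : ℚ)).mordellWeilRank + 1 ≤ (m * n * (m - n)).natAbs.primeFactors.card :=
  (Nat.pow_le_pow_iff_right (by norm_num)).mp (pow_mordellWeilRank_succ_le m n ψ hψ P₁ hP₁ h49 h7 h1)

variable (hbox : 7 ^ (m * n * (m - n)).natAbs.primeFactors.card ≤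
  Nat.card ((kubertTateSeven (m : ℚ) (n : ℚ)).toAffine.Point ⧸ (nsmulAddMonoidHom (7 : ℕ) :
    (kubertTateSeven (m : ℚ) (n : ℚ)).toAffine.Point →+ (kubertTateSeven (m : ℚ) (n : ℚ)).toAffine.Point).range))

include hψ hP₁ h49 h7 h1 hbox in
/-- **`Ш(E'/ℚ)[ψ] = 0` when the rational points fill the box**: if `#(E(ℚ)/7E(ℚ)) ≥ 7 ^ ω(mn(m−n))` then
`#(E(ℚ)/7E(ℚ)) · #ker Ш(ψ) = #Sel^ψ ≤ 7 ^ ω(mn(m−n))` forces `ker Ш(ψ) = ⊥`. [cite: SilvermanAEC2009, Thm. X.4.2(a) and Prop. X.4.9]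
[cite: Fisher2001FiveSevenDescent, §2] -/
private theorem ker_shaMap_dual_eq_bot_of_le :
    (shaMap ψ.toAddMonoidHom ψ.equivariant ψ.hasLocalPointsMaps_toAddMonoidHom).ker = ⊥ := by
  haveI := finite_ker_shaMap_dual m n ψ hψ
  have h := natCard_selmerGroup_dual_le m n ψ hψ P₁ hP₁ h49
  rw [natCard_selmerGroup_dual_eq m n ψ hψ h7 h1] at h
  have hpos : 0 < Nat.card (shaMap ψ.toAddMonoidHom ψ.equivariant ψ.hasLocalPointsMaps_toAddMonoidHom).ker :=
    Nat.card_pos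
  set K := Nat.card (shaMap ψ.toAddMonoidHom ψ.equivariant ψ.hasLocalPointsMaps_toAddMonoidHom).ker with hK
  set Q := Nat.card ((kubertTateSeven (m : ℚ) (n : ℚ)).toAffine.Point ⧸ (nsmulAddMonoidHom (7 : ℕ) :
    (kubertTateSeven (m : ℚ) (n : ℚ)).toAffine.Point →+ (kubertTateSeven (m : ℚ) (n : ℚ)).toAffine.Point).range) with hQ
  have hQpos : 0 < Q := lt_of_lt_of_le (pow_pos (by norm_num) _) hbox
  have hK1 : K ≤ 1 := by
    by_contra hK1
    have hK2 : 2 ≤ K := Nat.succ_le_of_lt (lt_of_not_ge hK1)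
    have h2 : Q * 2 ≤ Q := (Nat.mul_le_mul_left Q hK2).trans (h.trans hbox)
    linarith
  have hone : K = 1 := le_antisymm hK1 (Nat.succ_le_of_lt hpos)
  exact AddSubgroup.eq_bot_of_card_eq _ hone

include h7 h1 hP₁ h49 hbox in
/-- **`Ш(E_{m,n}/ℚ)[7] = 0` when the rational points fill the box** — the complete `7`-descent in the tame régime:
`Ш(E)[φ] = 0` (tree `KubertTateSevenVelu.ker_shaMap_sevenIsogeny_eq_bot`) and `Ш(E')[ψ] = 0` bracket `Ш(E)[7]`
(tree `sha_torsionBy_eq_bot_of_ker_shaMap_eq_bot`). [cite: SilvermanAEC2009, Thm. X.4.2(a)] [cite: Fisher2001FiveSevenDescent, §2] -/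
theorem sha_torsionBy_seven_eq_bot_of_le : (kubertTateSeven (m : ℚ) (n : ℚ)).sha[((7 : ℕ) : ℤ)] = ⊥ := by
  obtain ⟨ψ, hψ⟩ := exists_dual m n
  exact sha_torsionBy_eq_bot_of_ker_shaMap_eq_bot (sevenIsogeny (m : ℚ) (n : ℚ)) ψ (n := 7) (by norm_num) hψ
    (ConstantKernelDescent.ker_shaMap_eq_bot_of_selmerGroup_eq_bot (sevenIsogeny (m : ℚ) (n : ℚ))
      (KubertTateSevenVelu.selmerGroup_sevenIsogeny_eq_bot m n h7 h1))
    (ker_shaMap_dual_eq_bot_of_le m n ψ hψ P₁ hP₁ h49 h7 h1 hbox)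

include h7 h1 hP₁ h49 hbox in
/-- `Ш(E_{m,n}/ℚ)` has no element of order `7` (box full, tame). [cite: SilvermanAEC2009, Thm. X.4.2(a)] -/
theorem forall_mem_sha_seven_nsmul_eq_zero_of_le :
    ∀ c ∈ (kubertTateSeven (m : ℚ) (n : ℚ)).sha, (7 : ℕ) • c = 0 → c = 0 := by
  intro c hc h5c
  have hmem : (⟨c, hc⟩ : (kubertTateSeven (m : ℚ) (n : ℚ)).sha) ∈ (kubertTateSeven (m : ℚ) (n : ℚ)).sha[((7 : ℕ) : ℤ)] :=
    AddSubgroup.torsionBy.nsmul_iff.mpr (Subtype.ext h5c)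
  rw [sha_torsionBy_seven_eq_bot_of_le m n P₁ hP₁ h49 h7 h1 hbox, AddSubgroup.mem_bot] at hmem
  exact congrArg Subtype.val hmem

include h7 h1 hP₁ h49 hbox in
/-- **`t₇(E_{m,n}) = corank_{ℤ₇} Ш(E_{m,n}/ℚ)[7^∞] = 0` when the rational points fill the box (tame régime)** —
by descent alone, at any Mordell–Weil rank. [cite: SilvermanAEC2009, Thm. X.4.2(a)] [cite: Fisher2001FiveSevenDescent, §2] -/
theorem shaCorank_seven_eq_zero_of_le : (kubertTateSeven (m : ℚ) (n : ℚ)).shaCorank 7 = 0 :=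
  (kubertTateSeven (m : ℚ) (n : ℚ)).shaCorank_eq_zero_of_forall 7
    (forall_mem_sha_seven_nsmul_eq_zero_of_le m n P₁ hP₁ h49 h7 h1 hbox)

include h7 h1 hP₁ h49 hbox in
/-- **`Ш(E_{m,n}/ℚ)[7^∞] = 0`** when the rational points fill the box (tame régime). [cite: SilvermanAEC2009, Thm. X.4.2(a)] -/
theorem primaryComponent_sha_seven_eq_bot_of_le :
    AddCommGroup.primaryComponent (kubertTateSeven (m : ℚ) (n : ℚ)).sha 7 = ⊥ :=
  (kubertTateSeven (m : ℚ) (n : ℚ)).primaryComponent_sha_eq_bot_of_forall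
    (forall_mem_sha_seven_nsmul_eq_zero_of_le m n P₁ hP₁ h49 h7 h1 hbox)

include h7 h1 hP₁ h49 hbox in
/-- … and the box is then EXACTLY full: `#(E(ℚ)/7E(ℚ)) = 7 ^ ω(mn(m−n))`. [cite: SilvermanAEC2009, Thm. X.4.2(a)] -/
theorem natCard_quotient_eq_of_le :
    Nat.card ((kubertTateSeven (m : ℚ) (n : ℚ)).toAffine.Point ⧸ (nsmulAddMonoidHom (7 : ℕ) :
        (kubertTateSeven (m : ℚ) (n : ℚ)).toAffine.Point →+ (kubertTateSeven (m : ℚ) (n : ℚ)).toAffine.Point).range) =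
      7 ^ (m * n * (m - n)).natAbs.primeFactors.card := by
  obtain ⟨ψ, hψ⟩ := exists_dual m n
  exact le_antisymm (natCard_quotient_le m n ψ hψ P₁ hP₁ h49 h7 h1) hbox

end Tame

end KubertTateSevenMuDescent

end Literature.NumberTheory.EllipticCurves

end
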